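import Mathlib
import Literature.NumberTheory.LFunctions.Zhang2022.Section15CU1Local
import Literature.NumberTheory.Sieve.DivisorBound
import HarnessLib

/-!
# Zhang (2022), Lemma 15.3 (repaired normaliser): growth of `ϖ₁ⱼ`, absolute convergence of
# `Σₙ χ(n)τ₂(n)ϖ₁ⱼ(n)n^{−s}` and the Euler product `𝒰ᴿ₁ⱼ(s) = ∏_q 𝔲ᴿ₁ⱼ(q,s)` for `σ > 1`

Topic `Literature/NumberTheory/LFunctions/Zhang2022` (Landau–Siegel audit tree; verdict-neutral).
Y. Zhang, *Discrete mean estimates and the Landau–Siegel zero*, arXiv:2211.02515v1 (2022)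
[Zhang2022LandauSiegel] — **an unrefereed manuscript under adjudication; nothing in this file asserts
or denies its Theorems 1–2.** ZHANG-L discharge lane (WP15), fourth file of the chain towards the leaf
`Typed.Section15C.Lemma153RpI` (rows G-L4t3-1 / G-d52-1): the Euler-product sentence of the
Appendix-A sketch ("the Euler product representation `𝔲₁ⱼ(s) = ∏_q 𝔲₁ⱼ(q,s)`", p. 105, tex L5174;
typed for the repaired object as `Typed.AppendixA2.StepA_u030R`).

What is PROVED here (theorems only; no new definitions, no facts), under POINTWISE hypotheses on
`(D, χ, j)` that hold for all large `D` under (A) (`Lemma153Rp.eq15_18_at_betaJ`,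
`Lemma153Rp.inline15_varpiMult_holds`, §15.u035):

* `norm_varpi1_prime_pow_le` — `|ϖ₁ⱼ(qʳ)| ≤ 5B(r+1)` when `|𝓜₁(qᵃ,qᵇ;1−βⱼ)/𝓜₁(1,1;1−βⱼ)| ≤ B`;
* `norm_varpi1_le` — `|ϖ₁ⱼ(n)| ≤ (5B)^{ω(n)}τ₂(n)` (multiplicativity);
* `summable_norm_coeff` — `Σₙ |χ(n)τ₂(n)ϖ₁ⱼ(n)n^{−s}| < ∞` for `σ > 1` (divisor bound
  `Sieve.exists_card_divisors_le_mul_rpow`);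
* `hasProd_frakU1FactorR` / **`calU1R_eq_tprod`** — for `σ > 1`,
  `calU1R(s) = ∏'_q 𝔲ᴿ₁ⱼ(q,s)` (`Typed.AppendixA2.frakU1FactorR`), i.e. the body of `StepA_u030R`,
  from Mathlib's Euler products of `ζ(s)`, `L(s−βⱼ,χ)` and `EulerProduct.eulerProduct_hasProd`.

## References

* Y. Zhang, arXiv:2211.02515v1 (2022), §15 Lemma 15.3 p. 87; App. A p. 105.
  [cite: Zhang2022LandauSiegel, App. A p. 105]
-/

noncomputable section

open Complex Real Filter Topology Finset

namespace Literature.NumberTheory.LFunctions.Zhang2022.Lemma153Rp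

open Literature.NumberTheory.LFunctions.Zhang2022
open Literature.NumberTheory.LFunctions.Zhang2022.Typed.Section15A
open Literature.NumberTheory.LFunctions.Zhang2022.Typed.Section15B

/-! ## §0. Folklore on `ω` and `τ` (re-proved privately, as in `TypedSection15BEuler`) -/

/-- `2^{ω(n)} ≤ τ(n)` (`n ≥ 1`). [folklore] -/
private theorem two_pow_card_primeFactors_le_card_divisors {n : ℕ} (hn : n ≠ 0) :
    2 ^ n.primeFactors.card ≤ n.divisors.card := by
  rw [Nat.card_divisors hn]
  refine Finset.pow_card_le_prod _ _ _ fun p hp => ?_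
  have : 0 < n.factorization p := Nat.Prime.factorization_pos_of_dvd (Nat.prime_of_mem_primeFactors hp)
    hn (Nat.dvd_of_mem_primeFactors hp)
  omega

/-- `1 ≤ τ(n)` for `n ≥ 1`. [folklore] -/
private theorem one_le_card_divisors {n : ℕ} (hn : n ≠ 0) : 1 ≤ n.divisors.card :=
  Finset.card_pos.mpr ⟨1, Nat.one_mem_divisors.mpr hn⟩

/-- `A^{ω(n)} ≤ τ(n)^{log₂ A}` for `A ≥ 1`, `n ≥ 1`. [folklore] -/
private theorem pow_card_primeFactors_le_rpow_card_divisors {A : ℝ} (hA : 1 ≤ A) {n : ℕ} (hn : n ≠ 0) :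
    A ^ n.primeFactors.card ≤ (n.divisors.card : ℝ) ^ Real.logb 2 A := by
  have hA0 : 0 < A := one_pos.trans_le hA
  have ht : 0 ≤ Real.logb 2 A := Real.logb_nonneg one_lt_two hA
  have h2 : (2 : ℝ) ^ (n.primeFactors.card : ℝ) ≤ (n.divisors.card : ℝ) := by
    rw [Real.rpow_natCast]
    exact_mod_cast two_pow_card_primeFactors_le_card_divisors hn
  have hA2 : A = (2 : ℝ) ^ Real.logb 2 A := (Real.rpow_logb two_pos (by norm_num) hA0).symm
  calc A ^ n.primeFactors.card = ((2 : ℝ) ^ Real.logb 2 A) ^ (n.primeFactors.card : ℝ) := by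
        rw [Real.rpow_natCast, ← hA2]
    _ = ((2 : ℝ) ^ (n.primeFactors.card : ℝ)) ^ Real.logb 2 A := by
        rw [← Real.rpow_mul zero_le_two, mul_comm, Real.rpow_mul zero_le_two]
    _ ≤ (n.divisors.card : ℝ) ^ Real.logb 2 A :=
        Real.rpow_le_rpow (by positivity) h2 ht

variable (c' : ℝ) {D : ℕ} (χ : DirichletCharacter ℂ D)

/-! ## §1. Growth of `ϖ₁ⱼ` -/

/-- **`|ϖ₁ⱼ(qʳ)| ≤ 5B(r+1)`** at a prime power, given `|𝓜₁(qᵃ,qᵇ;1−βⱼ)/𝓜₁(1,1;1−βⱼ)| ≤ B` for all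
`a, b` (`|λ₁(qᵃ)| ≤ 5`, `|q^{aβⱼ}| = 1`, `|χ| ≤ 1`, `r+1` divisor pairs).
[cite: Zhang2022LandauSiegel, §15 p. 85] -/
theorem norm_varpi1_prime_pow_le {q : ℕ} (hq : q.Prime) (j : ℕ) {B : ℝ}
    (hB : ∀ a b : ℕ, ‖calM1 c' χ (q ^ a) (q ^ b) (1 - Skeleton.betaJ c' D j) /
      calM1 c' χ 1 1 (1 - Skeleton.betaJ c' D j)‖ ≤ B) (r : ℕ) :
    ‖varpi1 c' χ j (q ^ r)‖ ≤ 5 * B * ((r : ℝ) + 1) := by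
  have hB0 : 0 ≤ B := (norm_nonneg _).trans (hB 0 0)
  rw [varpi1_prime_pow_eq_sum_range c' χ hq j r]
  have hterm : ∀ a ∈ range (r + 1),
      ‖lam1 c' χ (q ^ a) 1 * ((q ^ a : ℕ) : ℂ) ^ Skeleton.betaJ c' D j * χ ((q ^ (r - a) : ℕ) : ZMod D) *
        (calM1 c' χ (q ^ a) (q ^ (r - a)) (1 - Skeleton.betaJ c' D j) /
          calM1 c' χ 1 1 (1 - Skeleton.betaJ c' D j))‖ ≤ 5 * B := by
    intro a _
    rw [norm_mul, norm_mul, norm_mul, norm_natCast_cpow_betaJ c' D j (Nat.one_le_pow _ _ hq.pos),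
      mul_one]
    have h1 : ‖lam1 c' χ (q ^ a) 1‖ ≤ 5 := by
      rcases Nat.eq_zero_or_pos a with h0 | h0
      · subst h0; rw [pow_zero, lam1_one, norm_one]; norm_num
      · rw [lam1_prime_pow c' χ hq h0]; exact norm_lam1_prime_one_le c' χ hq
    have h2 : ‖χ ((q ^ (r - a) : ℕ) : ZMod D)‖ ≤ 1 := χ.norm_le_one _
    calc ‖lam1 c' χ (q ^ a) 1‖ * ‖χ ((q ^ (r - a) : ℕ) : ZMod D)‖ *
          ‖calM1 c' χ (q ^ a) (q ^ (r - a)) (1 - Skeleton.betaJ c' D j) /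
            calM1 c' χ 1 1 (1 - Skeleton.betaJ c' D j)‖ ≤ 5 * 1 * B :=
          mul_le_mul (mul_le_mul h1 h2 (norm_nonneg _) (by norm_num)) (hB _ _) (norm_nonneg _)
            (by norm_num)
      _ = 5 * B := by ring
  calc _ ≤ ∑ a ∈ range (r + 1), (5 * B) := (norm_sum_le _ _).trans (sum_le_sum hterm)
    _ = 5 * B * ((r : ℝ) + 1) := by rw [sum_const, card_range, nsmul_eq_mul]; push_cast; ring

/-- **`|ϖ₁ⱼ(n)| ≤ (5B)^{ω(n)}τ₂(n)`** for `n ≥ 1`, from multiplicativity (§15 p. 85 inline,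
`Inline15_varpiMult`) and the prime-power bound. [cite: Zhang2022LandauSiegel, §15 p. 85] -/
theorem norm_varpi1_le (j : ℕ) {B : ℝ}
    (hB : ∀ q : ℕ, q.Prime → ∀ a b : ℕ, ‖calM1 c' χ (q ^ a) (q ^ b) (1 - Skeleton.betaJ c' D j) /
      calM1 c' χ 1 1 (1 - Skeleton.betaJ c' D j)‖ ≤ B)
    (hmult : varpi1 c' χ j 1 = 1 ∧
      ∀ m n : ℕ, Nat.Coprime m n → varpi1 c' χ j (m * n) = varpi1 c' χ j m * varpi1 c' χ j n)
    {n : ℕ} (hn : n ≠ 0) :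
    ‖varpi1 c' χ j n‖ ≤ (5 * B) ^ n.primeFactors.card * (n.divisors.card : ℝ) := by
  have hB0 : 0 ≤ B := (norm_nonneg _).trans (hB 2 Nat.prime_two 0 0)
  induction n using Nat.recOnPosPrimePosCoprime with
  | prime_pow p k hp hk =>
    rw [Nat.primeFactors_prime_pow hk.ne' hp, Finset.card_singleton, pow_one,
      Nat.divisors_prime_pow hp, Finset.card_map, Finset.card_range]
    push_cast
    exact norm_varpi1_prime_pow_le c' χ hp j (hB p hp) k
  | zero => exact absurd rfl hn
  | one =>
    rw [hmult.1, Nat.primeFactors_one, Finset.card_empty, pow_zero, Nat.divisors_one,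
      Finset.card_singleton]
    simp
  | coprime a b ha hb hab iha ihb =>
    have ha0 : a ≠ 0 := by omega
    have hb0 : b ≠ 0 := by omega
    rw [hmult.2 a b hab, norm_mul, Nat.Coprime.primeFactors_mul hab,
      Finset.card_union_of_disjoint hab.disjoint_primeFactors,
      Nat.Coprime.card_divisors_mul hab, Nat.cast_mul]
    calc ‖varpi1 c' χ j a‖ * ‖varpi1 c' χ j b‖
        ≤ ((5 * B) ^ a.primeFactors.card * (a.divisors.card : ℝ)) *
            ((5 * B) ^ b.primeFactors.card * (b.divisors.card : ℝ)) :=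
          mul_le_mul (iha ha0) (ihb hb0) (norm_nonneg _) (by positivity)
      _ = (5 * B) ^ (a.primeFactors.card + b.primeFactors.card) *
            ((a.divisors.card : ℝ) * (b.divisors.card : ℝ)) := by ring

/-- **`|χ(n)τ₂(n)ϖ₁ⱼ(n)| ≤ τ₂(n)^{2 + log₂(5B+1)}`** (`n ≥ 1`). [cite: Zhang2022LandauSiegel, §15 Lemma 15.3 p. 87] -/
theorem norm_coeff_le_rpow (j : ℕ) {B : ℝ}
    (hB : ∀ q : ℕ, q.Prime → ∀ a b : ℕ, ‖calM1 c' χ (q ^ a) (q ^ b) (1 - Skeleton.betaJ c' D j) /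
      calM1 c' χ 1 1 (1 - Skeleton.betaJ c' D j)‖ ≤ B)
    (hmult : varpi1 c' χ j 1 = 1 ∧
      ∀ m n : ℕ, Nat.Coprime m n → varpi1 c' χ j (m * n) = varpi1 c' χ j m * varpi1 c' χ j n)
    {n : ℕ} (hn : n ≠ 0) :
    ‖χ (n : ZMod D) * (n.divisors.card : ℂ) * varpi1 c' χ j n‖ ≤
      (n.divisors.card : ℝ) ^ ((2 : ℝ) + Real.logb 2 (5 * B + 1)) := by
  have hB0 : 0 ≤ B := (norm_nonneg _).trans (hB 2 Nat.prime_two 0 0)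
  have hA1 : (1 : ℝ) ≤ 5 * B + 1 := by linarith
  have hτ1 : (1 : ℝ) ≤ n.divisors.card := by exact_mod_cast one_le_card_divisors hn
  have hτ0 : (0 : ℝ) < n.divisors.card := one_pos.trans_le hτ1
  have h1 := norm_varpi1_le c' χ j hB hmult hn
  have h2 : (5 * B) ^ n.primeFactors.card ≤ (5 * B + 1) ^ n.primeFactors.card :=
    pow_le_pow_left₀ (by positivity) (by linarith) _
  have h3 := pow_card_primeFactors_le_rpow_card_divisors hA1 hn
  rw [norm_mul, norm_mul, Complex.norm_natCast]
  calc ‖χ (n : ZMod D)‖ * (n.divisors.card : ℝ) * ‖varpi1 c' χ j n‖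
      ≤ 1 * (n.divisors.card : ℝ) * ((5 * B) ^ n.primeFactors.card * (n.divisors.card : ℝ)) :=
        mul_le_mul (mul_le_mul_of_nonneg_right (χ.norm_le_one _) hτ0.le) h1 (norm_nonneg _)
          (by positivity)
    _ ≤ 1 * (n.divisors.card : ℝ) * ((n.divisors.card : ℝ) ^ Real.logb 2 (5 * B + 1) *
          (n.divisors.card : ℝ)) := by gcongr; exact h2.trans h3
    _ = (n.divisors.card : ℝ) ^ ((2 : ℝ) + Real.logb 2 (5 * B + 1)) := by
        rw [one_mul, Real.rpow_add hτ0, show (2 : ℝ) = ((2 : ℕ) : ℝ) by norm_num, Real.rpow_natCast]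
        ring

/-- **`Σₙ |χ(n)τ₂(n)ϖ₁ⱼ(n)n^{−s}| < ∞` for `σ > 1`** (the divisor-power bound and
`τ(n) ≤ C n^{δ/t}`, Hardy–Wright Thm 315 = `Sieve.exists_card_divisors_le_mul_rpow`).
[cite: Zhang2022LandauSiegel, §15 Lemma 15.3 p. 87] -/
theorem summable_norm_coeff (j : ℕ) {B : ℝ}
    (hB : ∀ q : ℕ, q.Prime → ∀ a b : ℕ, ‖calM1 c' χ (q ^ a) (q ^ b) (1 - Skeleton.betaJ c' D j) /
      calM1 c' χ 1 1 (1 - Skeleton.betaJ c' D j)‖ ≤ B)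
    (hmult : varpi1 c' χ j 1 = 1 ∧
      ∀ m n : ℕ, Nat.Coprime m n → varpi1 c' χ j (m * n) = varpi1 c' χ j m * varpi1 c' χ j n)
    {s : ℂ} (hs : 1 < s.re) :
    Summable fun n : ℕ => ‖LSeries.term
      (fun n => χ (n : ZMod D) * (n.divisors.card : ℂ) * varpi1 c' χ j n) s n‖ := by
  have hB0 : 0 ≤ B := (norm_nonneg _).trans (hB 2 Nat.prime_two 0 0)
  set t : ℝ := (2 : ℝ) + Real.logb 2 (5 * B + 1) with ht
  have hlogb : 0 ≤ Real.logb 2 (5 * B + 1) := Real.logb_nonneg one_lt_two (by linarith)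
  have ht0 : 0 < t := by rw [ht]; linarith
  set δ : ℝ := (s.re - 1) / 2 with hδ
  have hδ0 : 0 < δ := by rw [hδ]; linarith
  obtain ⟨C, hC1, hC⟩ := Literature.NumberTheory.Sieve.exists_card_divisors_le_mul_rpow
    (show 0 < δ / t by positivity)
  have hC0 : 0 ≤ C := zero_le_one.trans hC1
  have hexp : δ - s.re < -1 := by rw [hδ]; linarith
  have hmaj : Summable fun n : ℕ => C ^ t * (n : ℝ) ^ (δ - s.re) :=
    (Real.summable_nat_rpow.mpr hexp).mul_left _
  refine Summable.of_nonneg_of_le (fun _ => norm_nonneg _) (fun n => ?_) hmaj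
  rcases eq_or_ne n 0 with rfl | hn
  · simp only [LSeries.term_zero, norm_zero, Nat.cast_zero]
    exact mul_nonneg (Real.rpow_nonneg hC0 t) (Real.rpow_nonneg le_rfl _)
  have hnR : (0 : ℝ) < n := by exact_mod_cast Nat.pos_of_ne_zero hn
  have hτ0 : (0 : ℝ) ≤ n.divisors.card := Nat.cast_nonneg _
  rw [LSeries.term_of_ne_zero hn, norm_div, Complex.norm_natCast_cpow_of_pos (Nat.pos_of_ne_zero hn),
    div_le_iff₀ (Real.rpow_pos_of_pos hnR _)]
  have hτ : (n.divisors.card : ℝ) ≤ C * (n : ℝ) ^ (δ / t) := hC n hn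
  have hτt : (n.divisors.card : ℝ) ^ t ≤ (C * (n : ℝ) ^ (δ / t)) ^ t :=
    Real.rpow_le_rpow hτ0 hτ ht0.le
  calc ‖χ (n : ZMod D) * (n.divisors.card : ℂ) * varpi1 c' χ j n‖ ≤ (n.divisors.card : ℝ) ^ t :=
        norm_coeff_le_rpow c' χ j hB hmult hn
    _ ≤ (C * (n : ℝ) ^ (δ / t)) ^ t := hτt
    _ = C ^ t * (n : ℝ) ^ δ := by
        rw [Real.mul_rpow hC0 (Real.rpow_nonneg hnR.le _), ← Real.rpow_mul hnR.le,
          div_mul_cancel₀ δ ht0.ne']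
    _ = C ^ t * (n : ℝ) ^ (δ - s.re) * (n : ℝ) ^ s.re := by
        rw [mul_assoc, ← Real.rpow_add hnR]; congr 2; ring

/-! ## §2. The Euler product `𝒰ᴿ₁ⱼ(s) = ∏_q 𝔲ᴿ₁ⱼ(q,s)` for `σ > 1` -/

/-- `(qᵉ)ˢ = (qˢ)ᵉ` for naturals `q, e`. [folklore] -/
private theorem natCast_pow_cpow' (q e : ℕ) (s : ℂ) : ((q ^ e : ℕ) : ℂ) ^ s = ((q : ℂ) ^ s) ^ e := by
  induction e with
  | zero => simp
  | succ e ih => rw [pow_succ, Nat.cast_mul, Complex.natCast_mul_natCast_cpow, ih, pow_succ]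

/-- An Euler product with non-vanishing value may be inverted factorwise (in `ℂ`). [folklore] -/
private theorem hasProd_inv_of_ne_zero' {ι : Type*} {f : ι → ℂ} {a : ℂ} (hf : HasProd f a)
    (ha : a ≠ 0) : HasProd (fun i => (f i)⁻¹) a⁻¹ := by
  classical
  have hT : Tendsto (fun A : Finset ι => ∏ i ∈ A, f i) atTop (𝓝 a) := hf
  have hT' := hT.inv₀ ha
  have hfun : (fun A : Finset ι => ∏ i ∈ A, (f i)⁻¹) = fun A => (∏ i ∈ A, f i)⁻¹ := by
    funext A; rw [Finset.prod_inv_distrib]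
  show Tendsto (fun A : Finset ι => ∏ i ∈ A, (f i)⁻¹) atTop (𝓝 a⁻¹)
  rw [hfun]; exact hT'

/-- The `L`-series terms of `χ(n)τ₂(n)ϖ₁ⱼ(n)` are multiplicative on coprime arguments when `ϖ₁ⱼ`
is. [cite: Zhang2022LandauSiegel, §15 p. 85] -/
theorem term_coeff_mul_of_coprime (j : ℕ)
    (hmult : varpi1 c' χ j 1 = 1 ∧
      ∀ m n : ℕ, Nat.Coprime m n → varpi1 c' χ j (m * n) = varpi1 c' χ j m * varpi1 c' χ j n)
    (s : ℂ) {m n : ℕ} (hmn : Nat.Coprime m n) :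
    LSeries.term (fun k => χ (k : ZMod D) * (k.divisors.card : ℂ) * varpi1 c' χ j k) s (m * n) =
      LSeries.term (fun k => χ (k : ZMod D) * (k.divisors.card : ℂ) * varpi1 c' χ j k) s m *
        LSeries.term (fun k => χ (k : ZMod D) * (k.divisors.card : ℂ) * varpi1 c' χ j k) s n := by
  rcases eq_or_ne m 0 with rfl | hm
  · simp
  rcases eq_or_ne n 0 with rfl | hn
  · simp
  rw [LSeries.term_of_ne_zero (mul_ne_zero hm hn), LSeries.term_of_ne_zero hm,
    LSeries.term_of_ne_zero hn, hmult.2 m n hmn, Nat.Coprime.card_divisors_mul hmn,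
    Nat.cast_mul, Nat.cast_mul, map_mul, Nat.cast_mul, Complex.natCast_mul_natCast_cpow,
    div_mul_div_comm]
  ring

/-- **The Euler product of the repaired `𝒰₁ⱼ` for `σ > 1`**:
`HasProd (q ↦ 𝔲ᴿ₁ⱼ(q,s)) (calU1R(s))` — Mathlib's Euler products for `ζ(s)` and `L(s−βⱼ,χ)`
(`Re(s−βⱼ) = σ > 1`, both non-zero there) inverted and squared, times the Euler product of the
multiplicative coefficients `χ(n)τ₂(n)ϖ₁ⱼ(n)` (`EulerProduct.eulerProduct_hasProd`). Pointwise
hypotheses: `ϖ₁ⱼ` multiplicative and the ratio bound `B` (both true for all large `D` under (A)).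
[cite: Zhang2022LandauSiegel, App. A p. 105] -/
theorem hasProd_frakU1FactorR [NeZero D] (j : ℕ) {B : ℝ}
    (hB : ∀ q : ℕ, q.Prime → ∀ a b : ℕ, ‖calM1 c' χ (q ^ a) (q ^ b) (1 - Skeleton.betaJ c' D j) /
      calM1 c' χ 1 1 (1 - Skeleton.betaJ c' D j)‖ ≤ B)
    (hmult : varpi1 c' χ j 1 = 1 ∧
      ∀ m n : ℕ, Nat.Coprime m n → varpi1 c' χ j (m * n) = varpi1 c' χ j m * varpi1 c' χ j n)
    {s : ℂ} (hs : 1 < s.re) :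
    HasProd (fun q : Nat.Primes => Typed.AppendixA2.frakU1FactorR c' χ j (q : ℕ) s)
      (Typed.Section15C.calU1R c' Typed.Section15C.inputs15AB χ j s) := by
  classical
  set β : ℂ := Skeleton.betaJ c' D j with hβ
  set g : ℕ → ℂ := fun k => χ (k : ZMod D) * (k.divisors.card : ℂ) * varpi1 c' χ j k with hg
  have hsβ : 1 < (s - β).re := by rw [Complex.sub_re, hβ, betaJ_re, sub_zero]; exact hs
  -- Euler product of the coefficients
  have hg1 : LSeries.term g s 1 = 1 := by
    rw [LSeries.term_of_ne_zero one_ne_zero]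
    simp [hg, hmult.1]
  have hgE : HasProd (fun p : Nat.Primes => ∑' e : ℕ, LSeries.term g s ((p : ℕ) ^ e))
      (∑' n : ℕ, LSeries.term g s n) :=
    EulerProduct.eulerProduct_hasProd hg1 (fun hmn => term_coeff_mul_of_coprime c' χ j hmult s hmn)
      (summable_norm_coeff c' χ j hB hmult hs) (LSeries.term_zero _ _)
  -- the `ζ` and `L` products, inverted
  have hζne : riemannZeta s ≠ 0 := riemannZeta_ne_zero_of_one_lt_re hs
  have hLeq : LSeries (fun n => χ (n : ZMod D)) (s - β) = χ.LFunction (s - β) :=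
    (DirichletCharacter.LFunction_eq_LSeries χ hsβ).symm
  have hLne : LSeries (fun n => χ (n : ZMod D)) (s - β) ≠ 0 :=
    DirichletCharacter.LSeries_ne_zero_of_one_lt_re χ hsβ
  have hζ : HasProd (fun p : Nat.Primes => 1 - (p : ℂ) ^ (-s)) (riemannZeta s)⁻¹ := by
    have h := hasProd_inv_of_ne_zero' (riemannZeta_eulerProduct_hasProd hs) hζne
    simpa only [inv_inv] using h
  have hL : HasProd (fun p : Nat.Primes => 1 - χ ((p : ℕ) : ZMod D) * (p : ℂ) ^ (-(s - β)))
      (LSeries (fun n => χ (n : ZMod D)) (s - β))⁻¹ := by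
    have h := hasProd_inv_of_ne_zero' (DirichletCharacter.LSeries_eulerProduct_hasProd χ hsβ) hLne
    simpa only [inv_inv] using h
  have hN : HasProd (fun p : Nat.Primes => (1 - (p : ℂ) ^ (-s)) ^ 2 *
      (1 - χ ((p : ℕ) : ZMod D) * (p : ℂ) ^ (-(s - β))) ^ 2)
      (((riemannZeta s)⁻¹) ^ 2 * ((LSeries (fun n => χ (n : ZMod D)) (s - β))⁻¹) ^ 2) := by
    have h := (hζ.mul hζ).mul (hL.mul hL)
    simpa only [pow_two] using h
  -- the local factors of the coefficient product are the series in `frakU1FactorR`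
  have hloc : ∀ p : Nat.Primes, ∑' e : ℕ, LSeries.term g s ((p : ℕ) ^ e) =
      ∑' r : ℕ, χ (((p : ℕ) ^ r : ℕ) : ZMod D) * ((((p : ℕ) ^ r).divisors.card : ℕ) : ℂ) *
        varpi1 c' χ j ((p : ℕ) ^ r) / ((p : ℕ) : ℂ) ^ ((r : ℂ) * s) := by
    intro p
    refine tsum_congr fun e => ?_
    rw [LSeries.term_of_ne_zero (pow_ne_zero e p.prop.ne_zero), hg, natCast_pow_cpow',
      ← Complex.cpow_nat_mul]
  have hall := hN.mul hgE
  have hfun : (fun q : Nat.Primes => Typed.AppendixA2.frakU1FactorR c' χ j (q : ℕ) s) =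
      fun p : Nat.Primes => (1 - (p : ℂ) ^ (-s)) ^ 2 *
        (1 - χ ((p : ℕ) : ZMod D) * (p : ℂ) ^ (-(s - β))) ^ 2 *
          ∑' e : ℕ, LSeries.term g s ((p : ℕ) ^ e) := by
    funext p
    rw [hloc p]
    rfl
  rw [hfun]
  -- the value
  have hval : Typed.Section15C.calU1R c' Typed.Section15C.inputs15AB χ j s =
      ((riemannZeta s)⁻¹) ^ 2 * ((LSeries (fun n => χ (n : ZMod D)) (s - β))⁻¹) ^ 2 *
        ∑' n : ℕ, LSeries.term g s n := by
    unfold Typed.Section15C.calU1R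
    rw [Typed.Section15C.tsum_coeff_div_cpow_eq_LSeries, hLeq, mul_inv, inv_pow, inv_pow]
    rfl
  rw [hval]
  exact hall

/-- **`calU1R(s) = ∏'_q 𝔲ᴿ₁ⱼ(q,s)` for `σ > 1`** — the body of `Typed.AppendixA2.StepA_u030R` at
`(D, χ, j)`, under the pointwise hypotheses. [cite: Zhang2022LandauSiegel, App. A p. 105] -/
theorem calU1R_eq_tprod [NeZero D] (j : ℕ) {B : ℝ}
    (hB : ∀ q : ℕ, q.Prime → ∀ a b : ℕ, ‖calM1 c' χ (q ^ a) (q ^ b) (1 - Skeleton.betaJ c' D j) /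
      calM1 c' χ 1 1 (1 - Skeleton.betaJ c' D j)‖ ≤ B)
    (hmult : varpi1 c' χ j 1 = 1 ∧
      ∀ m n : ℕ, Nat.Coprime m n → varpi1 c' χ j (m * n) = varpi1 c' χ j m * varpi1 c' χ j n)
    {s : ℂ} (hs : 1 < s.re) :
    Typed.Section15C.calU1R c' Typed.Section15C.inputs15AB χ j s =
      ∏' q : Nat.Primes, Typed.AppendixA2.frakU1FactorR c' χ j (q : ℕ) s :=
  ((hasProd_frakU1FactorR c' χ j hB hmult hs).tprod_eq).symm

end Literature.NumberTheory.LFunctions.Zhang2022.Lemma153Rp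

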